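import Literature.MathematicalPhysics.QuantumFieldTheory.Balaban1983to89.Node00.SmallFieldChi29AxOfRecord
import Literature.MathematicalPhysics.QuantumFieldTheory.Balaban1983to89.BlockAxialRepresentativeCovariance
import Literature.MathematicalPhysics.QuantumFieldTheory.Balaban1983to89.B12RegularClassInvariance263
import Literature.MathematicalPhysics.QuantumFieldTheory.Balaban1983to89.B11GaugeGlue

/-!
# NODE 00 — `Node00.EuclCovAxOfRecord`: [Balaban1987RG1] (2.17) p. 269 ∕ p. 263 «Other symmetries are Euclidean lattice transformations … the
# explicitly defined expressions … are invariant» FOR THE RE-CENTRED RECORD OBJECTS of `Node00/SmallFieldChi29AxOfRecord` ([Ax-2]): on the [B11] domain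
# (solvability + ONE minimal orbit at the transformed field) the block-axial centre `V^{(k)}_{ax}(W) = critCfgAxOfRecord … W` is COVARIANT and the
# (2.9) cut-off `χ^{(2.9)}_{k,ax} = chiFix29AxOfRecord ∕ chiFixed29Ax` is INVARIANT under the coarse translations `τ_{La}`, the centre reflections `c_ρ`
# and (on admissible staircase families) the coordinate permutations `π` — porter PT-A-2 FILE E2 (row S5-0 (ii) of its PORT-PLAN, the Euclidean half of
# the symmetry hub feeding §5 (5.4)–(5.8) p. 292)

CITATION HEADER.  [I] = T. Bałaban, CMP **109** (1987) [Balaban1987RG1]: (2.17) p. 269 «(rU)(b) = U(rb) … By their definitions the expressions in (2.1) are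
invariant with respect to these transformations»; p. 263; (2.2)–(2.3) p. 265; (2.9) p. 266; [B11] = [Balaban1985Variational] Thm 1 p. 279 (solvability and
uniqueness of the minimal orbit — HYPOTHESES `UkExists`, `UniqueUkOrbit` here, never asserted).

WHAT IS PROVED (bookkeeping over tree theorems cited BY NAME).  §1 certificates: the averaging of record is nested-covariant
(`avOfRecord_nestedCovariant`, from `BlockAveraging.blockAvg_translate ∕ _creflect ∕ _permute`); the regularity class `bgReg` is invariant
(`B12RegularClassInvariance263.plaqSmall_*_iff`).  §2 `critCfgAxOfRecord_translate ∕ _creflect ∕ _permute_of_adm`: transport of minimality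
(`B12EuclClause263.IsBackground.translate ∕ .creflect ∕ .permute`), choice-freeness of the axial centre on the one-orbit domain
(`critCfgAxOfRecord_eq_of_isBackground`), covariance of the iterated averaging (`T4Continuum.iter_translate ∕ iter_creflect ∕ iter_permute`) and of the
block-axial representative (FILE E1 `BlockAxialRepresentative.axialize_contourData_*`).  §3 `fluctDevAxOfRecord_translate ∕ _creflect ∕ _permute_of_adm`
(the reflected `ρ`-bonds are traversed backwards, (2.18): `B11GaugeGlue.dist1_inv_mul_eq`) and the INVARIANCE of `chiFix29AxOfRecord`, `chiFix29AllAxOfRecord`,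
`chiFixed29Ax` (the excluded set `{b₀(c)}` is preserved: `B12ChiInvariance269.exists_b0_eq_translate_iff ∕ _cbond_iff`, `B12EuclClause263.exists_b0_eq_permute_iff`).
HONEST FRAMING.  Symmetry bookkeeping on the [B11] domain; [B11] Thm 1 and every estimate of Bałaban's stay HYPOTHESES ∕ unported; no `sorry`, standard
axioms; K0⁷∕K1⁹∕K3⁸ untouched; the Yang–Mills mass gap (Clay) is NOT proved by any of this.
-/

noncomputable section

namespace Literature.MathematicalPhysics.QuantumFieldTheory.Balaban1983to89.Node00

open T4Continuum
open GaugeField (gaugeAct)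
open BlockAxialRepresentative B12EuclClause263 B12ChiInvariance269

variable (F : T4Family) (N : ℕ) [NeZero N]

/-! ## §1. Certificates: the averaging of record is nested-covariant; the regularity class is invariant -/

/-- **The averaging of record commutes with the three generators of (2.17)** (the tree's (0.4) block averaging: `BlockAveraging.blockAvg_translate ∕
_creflect ∕ _permute`). [cite: Balaban1987RG1, (2.17) p.269, (0.4) p.253] -/
theorem avOfRecord_nestedCovariant (K : ℕ) : AveragingNestedCovariant (avOfRecord F N K) :=
  ⟨fun j a U => by rw [avOfRecord_apply]; exact BlockAveraging.blockAvg_translate _ a U,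
   fun j ρ U => by rw [avOfRecord_apply]; exact BlockAveraging.blockAvg_creflect _ ρ U,
   fun j π U => by rw [avOfRecord_apply]; exact BlockAveraging.blockAvg_permute _ π U⟩

/-- The regularity class (1.2) is translation invariant. [cite: Balaban1987RG1, (1.2) p.260, (2.17) p.269] -/
theorem bgReg_translate (K k : ℕ) (ε : ℝ) (a : Site (F.P K) 0) (U : GaugeField (F.P K) 0 (SU N)) (h : U ∈ bgReg F N K k ε) :
    U.translate a ∈ bgReg F N K k ε :=
  (B12RegularClassInvariance263.plaqSmall_translate_iff _ a U).2 h

/-- The regularity class (1.2) is invariant under the centre reflections. [cite: Balaban1987RG1, (1.2) p.260, (2.17) p.269] -/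
theorem bgReg_creflect (K k : ℕ) (ε : ℝ) (ρ : Fin (F.P K).d) (U : GaugeField (F.P K) 0 (SU N)) (h : U ∈ bgReg F N K k ε) :
    U.creflect ρ ∈ bgReg F N K k ε :=
  (B12RegularClassInvariance263.plaqSmall_creflect_iff _ ρ U).2 h

/-- The regularity class (1.2) is invariant under the coordinate permutations. [cite: Balaban1987RG1, (1.2) p.260, (2.17) p.269] -/
theorem bgReg_permute (K k : ℕ) (ε : ℝ) (π : Equiv.Perm (Fin (F.P K).d)) (U : GaugeField (F.P K) 0 (SU N)) (h : U ∈ bgReg F N K k ε) :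
    U.permute π ∈ bgReg F N K k ε :=
  (B12RegularClassInvariance263.plaqSmall_permute_iff _ π U).2 h

/-- The contour datum of record IS the tree's averaged contour variables (0.11) over the Federbush mean (`rfl`). [cite: Balaban1987RG1, (0.11) p.253 (bookkeeping)] -/
theorem contourOfRecord_eq (K k : ℕ) :
    contourOfRecord F N K k = BlockAveragingTwoLevel.contourData FederbushMean.federbushSU := rfl

variable {F N}

/-! ## §2. Covariance of the block-axial centre `V^{(k)}_{ax}(W)` on the [B11] domain -/

/-- **`V^{(k)}_{ax}(τ_a W) = τ_{La} V^{(k)}_{ax}(W)`** for `W` solvable with ONE minimal orbit at `τ_a W`. [cite: Balaban1987RG1, (2.17) p.269, (2.3) p.265; Balaban1985Variational, Thm 1 p.279] -/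
theorem critCfgAxOfRecord_translate {ν : Stage7Numerics} {K k : ℕ} (hk : k + 1 ≤ (F.P K).m + (F.P K).K) (a : Site (F.P K) (k + 1))
    {W : GaugeField (F.P K) (k + 1) (SU N)} (hex : UkExists F N K (k + 1) ν.εreg W)
    (huniq : UniqueUkOrbit F N K (k + 1) ν.εreg (W.translate a)) :
    critCfgAxOfRecord F N ν K k (W.translate a) = (critCfgAxOfRecord F N ν K k W).translate (Site.scale a) := by
  have hB := IsBackground.translate (avOfRecord_nestedCovariant F N K) (fun a' U hU => bgReg_translate F N K _ _ (Site.scaleTo (k + 1) a') U hU) (isBackground_Uk hex) a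
  rw [critCfgAxOfRecord_eq_of_isBackground (Nat.le_of_succ_le hk) huniq hB, critCfgAxOfRecord_def, critCfgOfRecord_def,
    show Site.scaleTo (k + 1) a = Site.scaleTo k (Site.scale a) from rfl,
    T4Continuum.iter_translate _ (avOfRecord_nestedCovariant F N K).1 k (Site.scale a), contourOfRecord_eq,
    axialize_contourData_translate _ hk]

/-- **`V^{(k)}_{ax}(c_ρ W) = c_ρ V^{(k)}_{ax}(W)`** for `W` solvable with ONE minimal orbit at `c_ρ W`. [cite: Balaban1987RG1, (2.17) p.269, (2.3) p.265; Balaban1985Variational, Thm 1 p.279] -/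
theorem critCfgAxOfRecord_creflect {ν : Stage7Numerics} {K k : ℕ} (hk : k + 1 ≤ (F.P K).m + (F.P K).K) (ρ : Fin (F.P K).d)
    {W : GaugeField (F.P K) (k + 1) (SU N)} (hex : UkExists F N K (k + 1) ν.εreg W)
    (huniq : UniqueUkOrbit F N K (k + 1) ν.εreg (W.creflect ρ)) :
    critCfgAxOfRecord F N ν K k (W.creflect ρ) = (critCfgAxOfRecord F N ν K k W).creflect ρ := by
  have hB := IsBackground.creflect (avOfRecord_nestedCovariant F N K) (fun ρ U hU => bgReg_creflect F N K _ _ ρ U hU) (isBackground_Uk hex) ρ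
  rw [critCfgAxOfRecord_eq_of_isBackground (Nat.le_of_succ_le hk) huniq hB, critCfgAxOfRecord_def, critCfgOfRecord_def,
    T4Continuum.iter_creflect _ ρ ((avOfRecord_nestedCovariant F N K).2.1 · ρ) k, contourOfRecord_eq,
    axialize_contourData_creflect _ hk]

/-- **`V^{(k)}_{ax}(π W) = π V^{(k)}_{ax}(W)`** for `W` solvable with ONE minimal orbit at `π W`, when the staircase families of the bare centre
`V^{(k)}(W)` from block centres to the points of their blocks are admissible for the Federbush mean (the small-field domain of (0.11)).
[cite: Balaban1987RG1, (2.17) p.269, (2.3) p.265, (0.11) p.253; Balaban1985Variational, Thm 1 p.279] -/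
theorem critCfgAxOfRecord_permute_of_adm {ν : Stage7Numerics} {K k : ℕ} (hk : k ≤ (F.P K).m + (F.P K).K) (π : Equiv.Perm (Fin (F.P K).d))
    {W : GaugeField (F.P K) (k + 1) (SU N)} (hex : UkExists F N K (k + 1) ν.εreg W)
    (huniq : UniqueUkOrbit F N K (k + 1) ν.εreg (W.permute π))
    (hadm : ∀ x : Site (F.P K) k, FederbushMean.federbushSU.Adm
      (BlockAveragingTwoLevel.stairHol (critCfgOfRecord F N ν K k W) (blockOf x) (BlockAveragingTwoLevel.offsetOf (blockOf x) x))) :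
    critCfgAxOfRecord F N ν K k (W.permute π) = (critCfgAxOfRecord F N ν K k W).permute π := by
  have hB := IsBackground.permute (avOfRecord_nestedCovariant F N K) (fun π U hU => bgReg_permute F N K _ _ π U hU) (isBackground_Uk hex) π
  rw [critCfgAxOfRecord_eq_of_isBackground hk huniq hB, critCfgAxOfRecord_def,
    T4Continuum.iter_permute _ π ((avOfRecord_nestedCovariant F N K).2.2 · π) k, contourOfRecord_eq, ← critCfgOfRecord_def,
    axialize_contourData_permute_of_adm _ π _ hadm]

/-! ## §3. Invariance of the (2.9) cut-off centred at `V^{(k)}_{ax}` -/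

/-- **`|V′(b)| ∘ τ`**: `fluctDevAx (τ_{La} V) b = fluctDevAx V (b + La)` on the [B11] domain. [cite: Balaban1987RG1, (2.17) p.269, (2.9) p.266] -/
theorem fluctDevAxOfRecord_translate {ν : Stage7Numerics} {K k : ℕ} (hk : k + 1 ≤ (F.P K).m + (F.P K).K) (a : Site (F.P K) (k + 1))
    (V : GaugeField (F.P K) k (SU N)) (hex : UkExists F N K (k + 1) ν.εreg ((avOfRecord F N K k).avg V))
    (huniq : UniqueUkOrbit F N K (k + 1) ν.εreg (((avOfRecord F N K k).avg V).translate a)) (b : PBond (F.P K) k) :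
    fluctDevAxOfRecord F N ν K k (V.translate (Site.scale a)) b = fluctDevAxOfRecord F N ν K k V (b.translate (Site.scale a)) := by
  rw [fluctDevAxOfRecord_apply, fluctDevAxOfRecord_apply, (avOfRecord_nestedCovariant F N K).1 k a V,
    critCfgAxOfRecord_translate hk a hex huniq, GaugeField.translate_apply, GaugeField.translate_apply]

/-- **`|V′(b)| ∘ c_ρ`**: `fluctDevAx (c_ρ V) b = fluctDevAx V (c_ρ b)` on the [B11] domain — on a `ρ`-bond both the centre and the field are read
backwards ((2.18)), and `|a b⁻¹ − 1| = |a⁻¹ b − 1|`. [cite: Balaban1987RG1, (2.17)–(2.18) p.269, (2.9) p.266] -/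
theorem fluctDevAxOfRecord_creflect {ν : Stage7Numerics} {K k : ℕ} (hk : k + 1 ≤ (F.P K).m + (F.P K).K) (ρ : Fin (F.P K).d)
    (V : GaugeField (F.P K) k (SU N)) (hex : UkExists F N K (k + 1) ν.εreg ((avOfRecord F N K k).avg V))
    (huniq : UniqueUkOrbit F N K (k + 1) ν.εreg (((avOfRecord F N K k).avg V).creflect ρ)) (b : PBond (F.P K) k) :
    fluctDevAxOfRecord F N ν K k (V.creflect ρ) b = fluctDevAxOfRecord F N ν K k V (cbond ρ b) := by
  rw [fluctDevAxOfRecord_apply, fluctDevAxOfRecord_apply, (avOfRecord_nestedCovariant F N K).2.1 k ρ V,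
    critCfgAxOfRecord_creflect hk ρ hex huniq, creflect_apply_cbond, creflect_apply_cbond]
  by_cases h : b.dir = ρ
  · rw [if_pos h, if_pos h, inv_inv, ← B11GaugeGlue.dist1_inv_mul_eq]
  · rw [if_neg h, if_neg h]

/-- **`|V′(b)| ∘ π`**: `fluctDevAx (π V) b = fluctDevAx V (π b)` on the [B11] domain, on admissible staircase families of the bare centre of `π⁻¹`-nothing —
of `V̄` itself. [cite: Balaban1987RG1, (2.17) p.269, (2.9) p.266, (0.11) p.253] -/
theorem fluctDevAxOfRecord_permute_of_adm {ν : Stage7Numerics} {K k : ℕ} (hk : k ≤ (F.P K).m + (F.P K).K) (π : Equiv.Perm (Fin (F.P K).d))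
    (V : GaugeField (F.P K) k (SU N)) (hex : UkExists F N K (k + 1) ν.εreg ((avOfRecord F N K k).avg V))
    (huniq : UniqueUkOrbit F N K (k + 1) ν.εreg (((avOfRecord F N K k).avg V).permute π))
    (hadm : ∀ x : Site (F.P K) k, FederbushMean.federbushSU.Adm
      (BlockAveragingTwoLevel.stairHol (critCfgOfRecord F N ν K k ((avOfRecord F N K k).avg V)) (blockOf x) (BlockAveragingTwoLevel.offsetOf (blockOf x) x)))
    (b : PBond (F.P K) k) :
    fluctDevAxOfRecord F N ν K k (V.permute π) b = fluctDevAxOfRecord F N ν K k V (b.permute π) := by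
  rw [fluctDevAxOfRecord_apply, fluctDevAxOfRecord_apply, (avOfRecord_nestedCovariant F N K).2.2 k π V,
    critCfgAxOfRecord_permute_of_adm hk π hex huniq hadm, GaugeField.permute_apply, GaugeField.permute_apply]

/-- **`χ^{(2.9)}_{k,ax}(τ_{La} V) = χ^{(2.9)}_{k,ax}(V)`** on the [B11] domain (the excluded set `{b₀(c)}` is translation invariant). [cite: Balaban1987RG1, (2.17) p.269, (2.9) p.266] -/
theorem chiFix29AxOfRecord_translate {ν : Stage7Numerics} (ε₁ : ℝ) {K k : ℕ} (hk : k + 1 ≤ (F.P K).m + (F.P K).K) (a : Site (F.P K) (k + 1))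
    (V : GaugeField (F.P K) k (SU N)) (hex : UkExists F N K (k + 1) ν.εreg ((avOfRecord F N K k).avg V))
    (huniq : UniqueUkOrbit F N K (k + 1) ν.εreg (((avOfRecord F N K k).avg V).translate a)) :
    chiFix29AxOfRecord F N ν ε₁ K k (V.translate (Site.scale a)) = chiFix29AxOfRecord F N ν ε₁ K k V := by
  have key : (∀ b : PBond (F.P K) k, ¬ IsB0 b → fluctDevAxOfRecord F N ν K k (V.translate (Site.scale a)) b < ε₁) ↔
      ∀ b : PBond (F.P K) k, ¬ IsB0 b → fluctDevAxOfRecord F N ν K k V b < ε₁ := by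
    simp only [fluctDevAxOfRecord_translate hk a V hex huniq]
    constructor
    · intro h b hb
      have h' := h (b.translate (Site.scale (-a))) (fun hb' => hb ((exists_b0_eq_translate_iff (-a) b).1 hb'))
      rwa [PBond.translate_translate, ← map_add, neg_add_cancel, map_zero, translate_zero_bond] at h'
    · intro h b hb
      exact h _ (fun hb' => hb ((exists_b0_eq_translate_iff a b).1 hb'))
  unfold chiFix29AxOfRecord
  by_cases hQ : ∀ b : PBond (F.P K) k, ¬ IsB0 b → fluctDevAxOfRecord F N ν K k V b < ε₁
  · rw [if_pos hQ, if_pos (key.2 hQ)]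
  · rw [if_neg hQ, if_neg fun h => hQ (key.1 h)]

/-- **`χ^{(2.9)}_{k,ax}(c_ρ V) = χ^{(2.9)}_{k,ax}(V)`** on the [B11] domain (the excluded set `{b₀(c)}` is invariant under the centre reflections). [cite: Balaban1987RG1, (2.17) p.269, (2.9) p.266] -/
theorem chiFix29AxOfRecord_creflect {ν : Stage7Numerics} (ε₁ : ℝ) {K k : ℕ} (hk : k + 1 ≤ (F.P K).m + (F.P K).K) (ρ : Fin (F.P K).d)
    (V : GaugeField (F.P K) k (SU N)) (hex : UkExists F N K (k + 1) ν.εreg ((avOfRecord F N K k).avg V))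
    (huniq : UniqueUkOrbit F N K (k + 1) ν.εreg (((avOfRecord F N K k).avg V).creflect ρ)) :
    chiFix29AxOfRecord F N ν ε₁ K k (V.creflect ρ) = chiFix29AxOfRecord F N ν ε₁ K k V := by
  have key : (∀ b : PBond (F.P K) k, ¬ IsB0 b → fluctDevAxOfRecord F N ν K k (V.creflect ρ) b < ε₁) ↔
      ∀ b : PBond (F.P K) k, ¬ IsB0 b → fluctDevAxOfRecord F N ν K k V b < ε₁ := by
    simp only [fluctDevAxOfRecord_creflect hk ρ V hex huniq]
    constructor
    · intro h b hb
      have h' := h (cbond ρ b) (fun hb' => hb ((exists_b0_eq_cbond_iff ρ b).1 hb'))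
      rwa [cbond_cbond] at h'
    · intro h b hb
      exact h _ (fun hb' => hb ((exists_b0_eq_cbond_iff ρ b).1 hb'))
  unfold chiFix29AxOfRecord
  by_cases hQ : ∀ b : PBond (F.P K) k, ¬ IsB0 b → fluctDevAxOfRecord F N ν K k V b < ε₁
  · rw [if_pos hQ, if_pos (key.2 hQ)]
  · rw [if_neg hQ, if_neg fun h => hQ (key.1 h)]

/-- **`χ^{(2.9)}_{k,ax}(π V) = χ^{(2.9)}_{k,ax}(V)`** on the [B11] domain and admissible staircase families (the excluded set `{b₀(c)}` is permutation invariant).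
[cite: Balaban1987RG1, (2.17) p.269, (2.9) p.266, (0.11) p.253] -/
theorem chiFix29AxOfRecord_permute_of_adm {ν : Stage7Numerics} (ε₁ : ℝ) {K k : ℕ} (hk : k ≤ (F.P K).m + (F.P K).K) (π : Equiv.Perm (Fin (F.P K).d))
    (V : GaugeField (F.P K) k (SU N)) (hex : UkExists F N K (k + 1) ν.εreg ((avOfRecord F N K k).avg V))
    (huniq : UniqueUkOrbit F N K (k + 1) ν.εreg (((avOfRecord F N K k).avg V).permute π))
    (hadm : ∀ x : Site (F.P K) k, FederbushMean.federbushSU.Adm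
      (BlockAveragingTwoLevel.stairHol (critCfgOfRecord F N ν K k ((avOfRecord F N K k).avg V)) (blockOf x) (BlockAveragingTwoLevel.offsetOf (blockOf x) x))) :
    chiFix29AxOfRecord F N ν ε₁ K k (V.permute π) = chiFix29AxOfRecord F N ν ε₁ K k V := by
  have key : (∀ b : PBond (F.P K) k, ¬ IsB0 b → fluctDevAxOfRecord F N ν K k (V.permute π) b < ε₁) ↔
      ∀ b : PBond (F.P K) k, ¬ IsB0 b → fluctDevAxOfRecord F N ν K k V b < ε₁ := by
    simp only [fluctDevAxOfRecord_permute_of_adm hk π V hex huniq hadm]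
    constructor
    · intro h b hb
      have h' := h (b.permute π⁻¹) (fun hb' => hb ((exists_b0_eq_permute_iff π⁻¹ b).1 hb'))
      rwa [PBond.permute_permute, mul_inv_cancel, PBond.permute_one] at h'
    · intro h b hb
      exact h _ (fun hb' => hb ((exists_b0_eq_permute_iff π b).1 hb'))
  unfold chiFix29AxOfRecord
  by_cases hQ : ∀ b : PBond (F.P K) k, ¬ IsB0 b → fluctDevAxOfRecord F N ν K k V b < ε₁
  · rw [if_pos hQ, if_pos (key.2 hQ)]
  · rw [if_neg hQ, if_neg fun h => hQ (key.1 h)]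

/-- **THE RE-CENTRED β-SLOT `chiFixed29Ax` IS EUCLIDEAN INVARIANT under the coarse translations** on the [B11] domain, for every coupling history. [cite: Balaban1987RG1, (2.17) p.269, (2.9) p.266] -/
theorem chiFixed29Ax_translate {ν : Stage7Numerics} (ε₁ : ℝ) {K k : ℕ} (hk : k + 1 ≤ (F.P K).m + (F.P K).K) (g : ℕ → ℝ) (a : Site (F.P K) (k + 1))
    (V : GaugeField (F.P K) k (SU N)) (hex : UkExists F N K (k + 1) ν.εreg ((avOfRecord F N K k).avg V))
    (huniq : UniqueUkOrbit F N K (k + 1) ν.εreg (((avOfRecord F N K k).avg V).translate a)) :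
    chiFixed29Ax F N ν ε₁ K g k (V.translate (Site.scale a)) = chiFixed29Ax F N ν ε₁ K g k V := by
  rw [chiFixed29Ax_apply]
  exact chiFix29AxOfRecord_translate ε₁ hk a V hex huniq

/-- **… AND under the centre reflections.** [cite: Balaban1987RG1, (2.17) p.269, (2.9) p.266] -/
theorem chiFixed29Ax_creflect {ν : Stage7Numerics} (ε₁ : ℝ) {K k : ℕ} (hk : k + 1 ≤ (F.P K).m + (F.P K).K) (g : ℕ → ℝ) (ρ : Fin (F.P K).d)
    (V : GaugeField (F.P K) k (SU N)) (hex : UkExists F N K (k + 1) ν.εreg ((avOfRecord F N K k).avg V))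
    (huniq : UniqueUkOrbit F N K (k + 1) ν.εreg (((avOfRecord F N K k).avg V).creflect ρ)) :
    chiFixed29Ax F N ν ε₁ K g k (V.creflect ρ) = chiFixed29Ax F N ν ε₁ K g k V := by
  rw [chiFixed29Ax_apply]
  exact chiFix29AxOfRecord_creflect ε₁ hk ρ V hex huniq

/-- **… AND under the coordinate permutations, on admissible staircase families.** [cite: Balaban1987RG1, (2.17) p.269, (2.9) p.266, (0.11) p.253] -/
theorem chiFixed29Ax_permute_of_adm {ν : Stage7Numerics} (ε₁ : ℝ) {K k : ℕ} (hk : k ≤ (F.P K).m + (F.P K).K) (g : ℕ → ℝ)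
    (π : Equiv.Perm (Fin (F.P K).d)) (V : GaugeField (F.P K) k (SU N)) (hex : UkExists F N K (k + 1) ν.εreg ((avOfRecord F N K k).avg V))
    (huniq : UniqueUkOrbit F N K (k + 1) ν.εreg (((avOfRecord F N K k).avg V).permute π))
    (hadm : ∀ x : Site (F.P K) k, FederbushMean.federbushSU.Adm
      (BlockAveragingTwoLevel.stairHol (critCfgOfRecord F N ν K k ((avOfRecord F N K k).avg V)) (blockOf x) (BlockAveragingTwoLevel.offsetOf (blockOf x) x))) :
    chiFixed29Ax F N ν ε₁ K g k (V.permute π) = chiFixed29Ax F N ν ε₁ K g k V := by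
  rw [chiFixed29Ax_apply]
  exact chiFix29AxOfRecord_permute_of_adm ε₁ hk π V hex huniq hadm

end Literature.MathematicalPhysics.QuantumFieldTheory.Balaban1983to89.Node00

end
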